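import Summits.NavierStokesRegularity.NavierStokesRegularity.Theorems.CoriolisHeadCounterRotatingLiouvilleWeightedBounds

/-!
# Route CoriolisHead · crux `CounterRotatingLiouville` (stmt-NavierStokesRegularity-22677) —
# towards stub 2 `stub_rssHeadGrowth`: local control of the pressure of a rotated profile

Support file of the line `tsai-rotating-head-chain` (theorems only; `--supports
stmt-NavierStokesRegularity-22677 --as helper`).  Second part of the port of the tree's
`FluidPDE/TsaiLocalPressure` (Tsai 1998, Lemma 2.1 localised, Remark 3.1) to the ROTATED profile
system `−νΔU + aU + a(y·∇)U + (BU − (By·∇)U) + (U·∇)U + ∇P = 0`, `div U = 0`, `B` skew: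

* `norm_fderiv_pressure_sub_localPressure_le_of_rotated` — interior gradient bound for the
  harmonic part `P − p̃[θ_{x₀,ρ}U]` on `B̄(x₀, ρ)`;
* `exists_local_pressure_bound_of_rotated` — `‖∇(P − p̃[θU])‖ ≤ K(1 + |x₀|)` on `B̄(x₀, ρ)` and
  `‖P − c_{x₀}‖_{L^p(B(x₀,ρ))} ≤ K(1 + |x₀|)`, given a uniform `L^p` bound on the localised
  normalised pressures;
* `exists_local_pressure_bound_of_four_le_of_rotated` — the unconditional `L²` instance for
  `U ∈ L^q`, `4 ≤ q ≤ ∞` (the bounded profiles of the crux are `q = ∞`).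

The proofs are those of the tree verbatim, with the two rotation terms contributing
`‖B‖ M₀ + M₁ ‖B‖ R` to the constants (`abs_integral_weight_mul_fderiv_pressure_le_of_rotated`).
NS regularity is NOT proved here.
-/

noncomputable section

-- the summit and its single sub-problem share the name (CONVENTIONS §1), as in every Theorems file
set_option linter.dupNamespace false

open MeasureTheory Set Function Filter Topology InnerProductSpace Metric
open scoped RealInnerProductSpace Laplacian ContDiff BigOperators ENNReal NNReal
open Literature.Analysis.FluidPDE

namespace Summit.NavierStokesRegularity.NavierStokesRegularity.Theorems.CoriolisHead

section LocalPressure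

-- nested operator types `ℝ³ →L[ℝ] ℝ³ →L[ℝ] ℝ³ →L[ℝ] ℝ`
set_option maxSynthPendingDepth 3

variable {ν a : ℝ} {B : EuclideanSpace ℝ (Fin 3) →L[ℝ] EuclideanSpace ℝ (Fin 3)}
  {U : EuclideanSpace ℝ (Fin 3) → EuclideanSpace ℝ (Fin 3)} {P : EuclideanSpace ℝ (Fin 3) → ℝ}
  {ρ : ℝ} {x₀ : EuclideanSpace ℝ (Fin 3)}

/-- **Interior gradient bound for the harmonic part of the pressure of a rotated profile** (port
of `IsLerayProfile.norm_fderiv_pressure_sub_localPressure_le`): with `N = p̃[θ_{x₀,ρ}U]`,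
`y ∈ B̄(x₀, ρ)`, weight bounds `M₀, M₁, M₂` and local bounds `A₁, A₂, A₃` as there,
`‖D(P − N)(y)‖ ≤ (ν M₂ + (a + ‖B‖) M₀ + a (M₁ (|x₀| + 3ρ) + 3 M₀) + M₁ ‖B‖ (|x₀| + 3ρ)) A₁ + M₁ A₂ + M₁ A₃`. -/
theorem norm_fderiv_pressure_sub_localPressure_le_of_rotated (hU : ContDiff ℝ ∞ U) (hP2 : ContDiff ℝ 2 P)
    (hB : ∀ x, ⟪B x, x⟫ = 0) (hdiv : VectorCalculus.IsDivFree U)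
    (heq : ∀ y, -(ν • (Δ U) y) + a • U y + a • fderiv ℝ U y y + (B (U y) - fderiv ℝ U y (B y)) +
      convect U U y + gradient P y = 0)
    (hν : 0 ≤ ν) (ha : 0 ≤ a) (hρ : 0 < ρ) {M₀ M₁ M₂ : ℝ} (hM₀ : 0 ≤ M₀)
    (hM₁ : 0 ≤ M₁) (hM₂ : 0 ≤ M₂) (hl0 : ∀ z : (EuclideanSpace ℝ (Fin 3)), |newtonFarLaplacian ρ (2 * ρ) z| ≤ M₀)
    (hl1 : ∀ z : (EuclideanSpace ℝ (Fin 3)), ‖fderiv ℝ (newtonFarLaplacian ρ (2 * ρ)) z‖ ≤ M₁)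
    (hl2 : ∀ z : (EuclideanSpace ℝ (Fin 3)), |(Δ (newtonFarLaplacian ρ (2 * ρ))) z| ≤ M₂) {y : (EuclideanSpace ℝ (Fin 3))}
    (hy : y ∈ closedBall x₀ ρ) {A₁ A₂ A₃ : ℝ} (hA₁ : ∫ w in closedBall y (2 * ρ), ‖U w‖ ≤ A₁)
    (hA₂ : ∫ w in closedBall y (2 * ρ), ‖U w‖ ^ 2 ≤ A₂)
    (hA₃ : ∫ w in closedBall y (2 * ρ), |normalisedPressure (fun w : EuclideanSpace ℝ (Fin 3) => cutoff (4 * ρ) (w - x₀) • U w) w| ≤ A₃) :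
    ‖fderiv ℝ (fun x => P x - normalisedPressure (fun w : EuclideanSpace ℝ (Fin 3) => cutoff (4 * ρ) (w - x₀) • U w) x) y‖ ≤
      (ν * M₂ + (a + ‖B‖) * M₀ + a * (M₁ * (‖x₀‖ + 3 * ρ) + 3 * M₀) + M₁ * ‖B‖ * (‖x₀‖ + 3 * ρ)) * A₁ + M₁ * A₂ + M₁ * A₃ := by
  have h₁ : ρ < 2 * ρ := by linarith
  have h₂ : 2 * ρ < 3 * ρ := by linarith
  set lam := newtonFarLaplacian ρ (2 * ρ) with hlam
  have hls : ContDiff ℝ 1 lam := contDiff_newtonFarLaplacian hρ h₁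
  have hlc : HasCompactSupport lam := hasCompactSupport_newtonFarLaplacian hρ.le h₁
  set N := normalisedPressure (fun w : EuclideanSpace ℝ (Fin 3) => cutoff (4 * ρ) (w - x₀) • U w) with hN
  have hP1 : ContDiff ℝ 1 P := hP2.of_le one_le_two
  have hN2 : ContDiff ℝ 2 N := contDiff_normalisedPressure_locF hU hρ (x₀ := x₀)
  set h : (EuclideanSpace ℝ (Fin 3)) → ℝ := fun x => P x - N x with hh
  have hh2 : ContDiff ℝ 2 h := hP2.sub hN2
  -- harmonic on `B(y, 3ρ) ⊆ B(x₀, 4ρ)`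
  have hΔ : ∀ w ∈ ball y (3 * ρ), (Δ h) w = 0 := by
    intro w hw
    refine laplacian_pressure_sub_localPressure_eq_zero_of_rotated hU hP2 hdiv heq hρ ?_
    rw [mem_ball] at hw ⊢
    rw [mem_closedBall] at hy
    calc dist w x₀ ≤ dist w y + dist y x₀ := dist_triangle _ _ _
      _ < 3 * ρ + ρ := add_lt_add_of_lt_of_le hw hy
      _ = 4 * ρ := by ring
  -- the reflected weight
  obtain ⟨hΨ2, hΨc, hΨS, hΨ0, hΨ1, hΨ2'⟩ := reflectedWeight_props hρ y hl0 hl1 hl2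
  have hSR : ∀ w ∈ closedBall y (2 * ρ), ‖w‖ ≤ ‖x₀‖ + 3 * ρ := fun w hw => by
    rw [mem_closedBall, dist_eq_norm] at hw hy
    calc ‖w‖ = ‖(w - y) + (y - x₀) + x₀‖ := by abel_nf
      _ ≤ ‖w - y‖ + ‖y - x₀‖ + ‖x₀‖ := norm_add₃_le
      _ ≤ 2 * ρ + ρ + ‖x₀‖ := by gcongr
      _ = ‖x₀‖ + 3 * ρ := by ring
  have hR : 0 ≤ ‖x₀‖ + 3 * ρ := by positivity
  -- the bound in each direction `e`
  have key : ∀ e : (EuclideanSpace ℝ (Fin 3)), ‖fderiv ℝ h y e‖ ≤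
      ((ν * M₂ + (a + ‖B‖) * M₀ + a * (M₁ * (‖x₀‖ + 3 * ρ) + 3 * M₀) + M₁ * ‖B‖ * (‖x₀‖ + 3 * ρ)) * A₁ + M₁ * A₂ + M₁ * A₃) * ‖e‖ := by
    intro e
    rw [Real.norm_eq_abs,
      fderiv_apply_eq_integral_fderiv_newtonFarLaplacian_mul hρ h₁ hh2 h₂ hΔ e]
    -- split `h = P − N`
    have hiP : Integrable fun z => fderiv ℝ lam z e * P (y - z) :=
      (((hls.continuous_fderiv one_ne_zero).clm_apply continuous_const).mul
        (hP1.continuous.comp (continuous_const.sub continuous_id))).integrable_of_hasCompactSupport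
        (hlc.fderiv_apply (𝕜 := ℝ) e).mul_right
    have hiN : Integrable fun z => fderiv ℝ lam z e * N (y - z) :=
      (((hls.continuous_fderiv one_ne_zero).clm_apply continuous_const).mul
        (hN2.continuous.comp (continuous_const.sub continuous_id))).integrable_of_hasCompactSupport
        (hlc.fderiv_apply (𝕜 := ℝ) e).mul_right
    have hsplit : ∫ z, fderiv ℝ lam z e * h (y - z) =
        (∫ z, fderiv ℝ lam z e * P (y - z)) - ∫ z, fderiv ℝ lam z e * N (y - z) := by
      rw [← integral_sub hiP hiN]
      refine integral_congr_ae (Eventually.of_forall fun z => ?_)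
      simp only [hh]
      ring
    -- the `P` part: derivative onto `P`, then the weighted bound
    have hPpart : |∫ z, fderiv ℝ lam z e * P (y - z)| ≤
        ‖e‖ * ((ν * M₂ + (a + ‖B‖) * M₀ + a * (M₁ * (‖x₀‖ + 3 * ρ) + 3 * M₀) + M₁ * ‖B‖ * (‖x₀‖ + 3 * ρ)) * A₁ + M₁ * A₂) := by
      rw [integral_fderiv_mul_comp_sub hls hlc hP1 y e]
      have hcv : ∫ z, lam z * fderiv ℝ P (y - z) e = ∫ w, lam (y - w) * fderiv ℝ P w e := by
        rw [← integral_sub_left_eq_self (fun z => lam z * fderiv ℝ P (y - z) e) volume y]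
        refine integral_congr_ae (Eventually.of_forall fun w => ?_)
        simp only [sub_sub_cancel]
      rw [hcv]
      have hb := abs_integral_weight_mul_fderiv_pressure_le_of_rotated hU hB hdiv heq hν ha hΨ2 hΨc
        measurableSet_closedBall (isCompact_closedBall y (2 * ρ)) hΨS hM₀ hM₁ hM₂ hR hΨ0 hΨ1 hΨ2'
        hSR e
      refine hb.trans ?_
      have hJ1 : 0 ≤ ∫ w in closedBall y (2 * ρ), ‖U w‖ := integral_nonneg fun w => norm_nonneg _
      have hJ2 : 0 ≤ ∫ w in closedBall y (2 * ρ), ‖U w‖ ^ 2 := integral_nonneg fun w => by positivity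
      have hcoef : 0 ≤ ν * M₂ + (a + ‖B‖) * M₀ + a * (M₁ * (‖x₀‖ + 3 * ρ) + 3 * M₀) +
          M₁ * ‖B‖ * (‖x₀‖ + 3 * ρ) := by positivity
      gcongr
    -- the `N` part
    have hNpart : |∫ z, fderiv ℝ lam z e * N (y - z)| ≤ ‖e‖ * (M₁ * A₃) := by
      have hcv : ∫ z, fderiv ℝ lam z e * N (y - z) = ∫ w, fderiv ℝ lam (y - w) e * N w := by
        rw [← integral_sub_left_eq_self (fun z => fderiv ℝ lam z e * N (y - z)) volume y]
        refine integral_congr_ae (Eventually.of_forall fun w => ?_)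
        simp only [sub_sub_cancel]
      rw [hcv]
      have hIN : IntegrableOn (fun w => |N w|) (closedBall y (2 * ρ)) :=
        hN2.continuous.abs.continuousOn.integrableOn_compact (isCompact_closedBall _ _)
      have hb := abs_integral_le_of_support_subset (f := fun w => fderiv ℝ lam (y - w) e * N w)
        (g := fun w => |N w|) (C := ‖e‖ * M₁) measurableSet_closedBall (fun w hw => ?_)
        (fun w _ => ?_) hIN
      · refine hb.trans ?_
        rw [mul_assoc]
        gcongr
      · have hw' : 2 * ρ < ‖y - w‖ := by
          rw [mem_closedBall, dist_comm, dist_eq_norm, not_le] at hw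
          exact hw
        have : fderiv ℝ lam (y - w) = 0 := by
          refine fderiv_of_notMem_tsupport ℝ fun hmem => ?_
          have := tsupport_newtonFarLaplacian_subset hρ.le h₁ hmem
          rw [mem_closedBall_zero_iff] at this
          linarith
        show fderiv ℝ lam (y - w) e * N w = 0
        rw [this, _root_.zero_apply, zero_mul]
      · show |fderiv ℝ lam (y - w) e * N w| ≤ ‖e‖ * M₁ * |N w|
        rw [abs_mul]
        gcongr
        rw [← Real.norm_eq_abs]
        calc ‖fderiv ℝ lam (y - w) e‖ ≤ ‖fderiv ℝ lam (y - w)‖ * ‖e‖ := ContinuousLinearMap.le_opNorm _ _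
          _ ≤ M₁ * ‖e‖ := by gcongr; exact hl1 _
          _ = ‖e‖ * M₁ := mul_comm _ _
    rw [hsplit]
    calc |(∫ z, fderiv ℝ lam z e * P (y - z)) - ∫ z, fderiv ℝ lam z e * N (y - z)|
        ≤ |∫ z, fderiv ℝ lam z e * P (y - z)| + |∫ z, fderiv ℝ lam z e * N (y - z)| := abs_sub _ _
      _ ≤ ‖e‖ * ((ν * M₂ + (a + ‖B‖) * M₀ + a * (M₁ * (‖x₀‖ + 3 * ρ) + 3 * M₀) + M₁ * ‖B‖ * (‖x₀‖ + 3 * ρ)) * A₁ + M₁ * A₂) +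
          ‖e‖ * (M₁ * A₃) := add_le_add hPpart hNpart
      _ = ((ν * M₂ + (a + ‖B‖) * M₀ + a * (M₁ * (‖x₀‖ + 3 * ρ) + 3 * M₀) + M₁ * ‖B‖ * (‖x₀‖ + 3 * ρ)) * A₁ + M₁ * A₂ + M₁ * A₃) * ‖e‖ := by
          ring
  have hK : 0 ≤ (ν * M₂ + (a + ‖B‖) * M₀ + a * (M₁ * (‖x₀‖ + 3 * ρ) + 3 * M₀) + M₁ * ‖B‖ * (‖x₀‖ + 3 * ρ)) * A₁ + M₁ * A₂ + M₁ * A₃ := by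
    have h0 := key 0
    -- evaluate the bound with a unit-free argument: use any `e` with `‖e‖ = 1`
    obtain ⟨e, he⟩ : ∃ e : (EuclideanSpace ℝ (Fin 3)), ‖e‖ = 1 := exists_norm_eq (EuclideanSpace ℝ (Fin 3)) zero_le_one
    have h1 := key e
    rw [he, mul_one] at h1
    exact (norm_nonneg _).trans h1
  exact ContinuousLinearMap.opNorm_le_bound _ hK key

/-- Arithmetic for the linear growth of the gradient constant in the centre:
`c(t) ≤ c(1) (1 + t)` for the affine-in-`t` coefficient of the gradient bound. -/
theorem coef_bound_aux {ν a nB M₀ M₁ M₂ ρ t A₁ A₂ A₃ : ℝ} (hν : 0 ≤ ν) (ha : 0 ≤ a)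
    (hnB : 0 ≤ nB) (hM₀ : 0 ≤ M₀) (hM₁ : 0 ≤ M₁) (hM₂ : 0 ≤ M₂) (hρ : 0 ≤ ρ) (ht : 0 ≤ t)
    (hA₁ : 0 ≤ A₁) (hA₂ : 0 ≤ A₂) (hA₃ : 0 ≤ A₃) :
    (ν * M₂ + (a + nB) * M₀ + a * (M₁ * (t + 3 * ρ) + 3 * M₀) + M₁ * nB * (t + 3 * ρ)) * A₁ +
        M₁ * A₂ + M₁ * A₃ ≤
      ((ν * M₂ + (a + nB) * M₀ + a * (M₁ * (1 + 3 * ρ) + 3 * M₀) + M₁ * nB * (1 + 3 * ρ)) * A₁ +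
        M₁ * A₂ + M₁ * A₃) * (1 + t) := by
  rw [← sub_nonneg]
  have key : ((ν * M₂ + (a + nB) * M₀ + a * (M₁ * (1 + 3 * ρ) + 3 * M₀) + M₁ * nB * (1 + 3 * ρ)) * A₁ +
        M₁ * A₂ + M₁ * A₃) * (1 + t) -
      ((ν * M₂ + (a + nB) * M₀ + a * (M₁ * (t + 3 * ρ) + 3 * M₀) + M₁ * nB * (t + 3 * ρ)) * A₁ +
        M₁ * A₂ + M₁ * A₃) =
      (ν * M₂ + (a + nB) * M₀ + a * (3 * M₀)) * A₁ * t + (a * M₁ + M₁ * nB) * A₁ * (1 + 3 * ρ * t) +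
        (M₁ * A₂ + M₁ * A₃) * t := by ring
  rw [key]
  positivity

set_option maxHeartbeats 400000 in
/-- **Local control of the pressure of a rotated profile up to constants** (port of
`IsLerayProfile.exists_local_pressure_bound`): `U ∈ C^∞ ∩ L^q`, `2 ≤ q ≤ ∞`, `ρ > 0`,
`1 ≤ p ≤ ∞`, localised normalised pressures bounded in `L^p` uniformly in the centre ⇒ there is
`K` with `‖∇(P − p̃[θ_{x₀,ρ}U])‖ ≤ K (1 + |x₀|)` on `B̄(x₀, ρ)` and
`‖P − c_{x₀}‖_{L^p(B(x₀, ρ))} ≤ K (1 + |x₀|)` for every centre `x₀`. -/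
theorem exists_local_pressure_bound_of_rotated (hU : ContDiff ℝ ∞ U) (hP2 : ContDiff ℝ 2 P)
    (hB : ∀ x, ⟪B x, x⟫ = 0) (hdiv : VectorCalculus.IsDivFree U)
    (heq : ∀ y, -(ν • (Δ U) y) + a • U y + a • fderiv ℝ U y y + (B (U y) - fderiv ℝ U y (B y)) +
      convect U U y + gradient P y = 0)
    (hν : 0 ≤ ν) (ha : 0 ≤ a) (hρ : 0 < ρ) {q : ℝ≥0∞} (hq : 2 ≤ q)
    (hUq : MemLp U q volume) {p : ℝ≥0∞} (hp : 1 ≤ p) {Bn : ℝ} (hBn0 : 0 ≤ Bn)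
    (hN : ∀ x₀ : (EuclideanSpace ℝ (Fin 3)), eLpNorm (normalisedPressure (fun w : EuclideanSpace ℝ (Fin 3) =>
      cutoff (4 * ρ) (w - x₀) • U w)) p volume ≤ ENNReal.ofReal Bn) :
    ∃ K : ℝ, 0 ≤ K ∧ ∀ x₀ : (EuclideanSpace ℝ (Fin 3)),
      (∀ y ∈ closedBall x₀ ρ, ‖fderiv ℝ (fun x => P x - normalisedPressure
        (fun w : EuclideanSpace ℝ (Fin 3) => cutoff (4 * ρ) (w - x₀) • U w) x) y‖ ≤ K * (1 + ‖x₀‖)) ∧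
      eLpNorm (fun x => P x - (P x₀ - normalisedPressure
        (fun w : EuclideanSpace ℝ (Fin 3) => cutoff (4 * ρ) (w - x₀) • U w) x₀)) p
        (volume.restrict (ball x₀ ρ)) ≤ ENNReal.ofReal (K * (1 + ‖x₀‖)) := by
  -- the weight bounds and the uniform local bounds on `U`
  obtain ⟨M₀, M₁, M₂, hM₀, hM₁, hM₂, hl0, hl1, hl2⟩ := exists_bounds_newtonFarLaplacian hρ
  obtain ⟨MU, hMU⟩ : ∃ MU : ℝ, 0 ≤ MU ∧ eLpNorm U q volume ≤ ENNReal.ofReal MU :=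
    ⟨(eLpNorm U q volume).toReal, ENNReal.toReal_nonneg, (ENNReal.ofReal_toReal hUq.eLpNorm_ne_top).ge⟩
  have hq1 : 1 ≤ q := le_trans (by norm_num) hq
  set C₁ : ℝ := ((volume (closedBall (0 : (EuclideanSpace ℝ (Fin 3))) (2 * ρ))) ^ (1 - 1 / q.toReal)).toReal with hC₁
  set C₂ : ℝ := ((volume (closedBall (0 : (EuclideanSpace ℝ (Fin 3))) (2 * ρ))) ^ (1 - 1 / (q / 2).toReal)).toReal with hC₂
  set C₃ : ℝ := ((volume (closedBall (0 : (EuclideanSpace ℝ (Fin 3))) (2 * ρ))) ^ (1 - 1 / p.toReal)).toReal with hC₃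
  set A₁ := C₁ * MU with hA₁
  set A₂ := C₂ * MU ^ 2 with hA₂
  set A₃ := C₃ * Bn with hA₃
  have hA₁0 : 0 ≤ A₁ := mul_nonneg ENNReal.toReal_nonneg hMU.1
  have hA₂0 : 0 ≤ A₂ := mul_nonneg ENNReal.toReal_nonneg (sq_nonneg _)
  have hA₃0 : 0 ≤ A₃ := mul_nonneg ENNReal.toReal_nonneg hBn0
  have hUA₁ : ∀ y, ∫ w in closedBall y (2 * ρ), ‖U w‖ ≤ A₁ := fun y =>
    (setIntegral_norm_le_of_eLpNorm_le hU.continuous.aestronglyMeasurable hq1 hMU.1 hMU.2 y (2 * ρ)).2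
  have hUA₂ : ∀ y, ∫ w in closedBall y (2 * ρ), ‖U w‖ ^ 2 ≤ A₂ := fun y =>
    setIntegral_norm_sq_le_of_eLpNorm_le hU.continuous hq hMU.1 hMU.2 y (2 * ρ)
  -- the constant: gradient bound `G(x₀) ≤ K₁ (1 + |x₀|)`, then `L^p` bound
  set K₁ : ℝ := (ν * M₂ + (a + ‖B‖) * M₀ + a * (M₁ * (1 + 3 * ρ) + 3 * M₀) + M₁ * ‖B‖ * (1 + 3 * ρ)) * A₁ +
    M₁ * A₂ + M₁ * A₃ with hK₁
  have hK₁0 : 0 ≤ K₁ := by positivity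
  set V : ℝ := ((volume (ball (0 : (EuclideanSpace ℝ (Fin 3))) ρ)) ^ p.toReal⁻¹).toReal with hV
  have hV0 : 0 ≤ V := ENNReal.toReal_nonneg
  have hVlt : (volume (ball (0 : (EuclideanSpace ℝ (Fin 3))) ρ)) ^ p.toReal⁻¹ < ⊤ :=
    ENNReal.rpow_lt_top_of_nonneg (inv_nonneg.2 ENNReal.toReal_nonneg) measure_ball_lt_top.ne
  set K : ℝ := V * ρ * K₁ + Bn + K₁ with hK
  refine ⟨K, by positivity, fun x₀ => ?_⟩
  set N := normalisedPressure (fun w : EuclideanSpace ℝ (Fin 3) => cutoff (4 * ρ) (w - x₀) • U w) with hNd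
  have hNc : Continuous N := (contDiff_normalisedPressure_locF hU hρ (x₀ := x₀)).continuous
  have hNA₃ : ∀ y, ∫ w in closedBall y (2 * ρ), |N w| ≤ A₃ := fun y => by
    have h := (setIntegral_norm_le_of_eLpNorm_le hNc.aestronglyMeasurable hp hBn0 (hN x₀) y (2 * ρ)).2
    simpa only [Real.norm_eq_abs] using h
  -- gradient bound on the closed ball
  have hgrad : ∀ y ∈ closedBall x₀ ρ, ‖fderiv ℝ (fun x => P x - N x) y‖ ≤ K₁ * (1 + ‖x₀‖) := by
    intro y hy
    have h := norm_fderiv_pressure_sub_localPressure_le_of_rotated hU hP2 hB hdiv heq hν ha hρ hM₀ hM₁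
      hM₂ hl0 hl1 hl2 hy (hUA₁ y) (hUA₂ y) (hNA₃ y)
    refine h.trans ?_
    rw [hK₁]
    exact coef_bound_aux hν ha (norm_nonneg B) hM₀ hM₁ hM₂ hρ.le (norm_nonneg x₀) hA₁0 hA₂0 hA₃0
  have hK₁K : K₁ ≤ K := by rw [hK]; nlinarith [mul_nonneg (mul_nonneg hV0 hρ.le) hK₁0]
  refine ⟨fun y hy => (hgrad y hy).trans (mul_le_mul_of_nonneg_right hK₁K (by positivity)), ?_⟩
  -- `L^p` bound: `P − c = (h − h(x₀)) + N` on the ball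
  have hN2 : ContDiff ℝ 2 N := contDiff_normalisedPressure_locF hU hρ (x₀ := x₀)
  have hh1 : ContDiff ℝ 1 (fun x => P x - N x) := (hP2.sub hN2).of_le one_le_two
  have hmv : ∀ x ∈ closedBall x₀ ρ, |(P x - N x) - (P x₀ - N x₀)| ≤ K₁ * (1 + ‖x₀‖) * ρ := by
    intro x hx
    have h := (convex_closedBall x₀ ρ).norm_image_sub_le_of_norm_fderiv_le (f := fun x => P x - N x)
      (fun z _ => (hh1.differentiable one_ne_zero z)) hgrad (mem_closedBall_self hρ.le) hx
    rw [Real.norm_eq_abs] at h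
    refine h.trans ?_
    rw [mem_closedBall, dist_eq_norm] at hx
    have : 0 ≤ K₁ * (1 + ‖x₀‖) := by positivity
    exact mul_le_mul_of_nonneg_left hx this
  have hdecomp : (fun x => P x - (P x₀ - N x₀)) = (fun x => (P x - N x) - (P x₀ - N x₀)) + N := by
    funext x; simp only [Pi.add_apply]; ring
  rw [hdecomp]
  have hmeas1 : AEStronglyMeasurable (fun x => (P x - N x) - (P x₀ - N x₀)) (volume.restrict (ball x₀ ρ)) :=
    (hh1.continuous.sub continuous_const).aestronglyMeasurable
  have hmeas2 : AEStronglyMeasurable N (volume.restrict (ball x₀ ρ)) := hNc.aestronglyMeasurable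
  calc eLpNorm ((fun x => (P x - N x) - (P x₀ - N x₀)) + N) p (volume.restrict (ball x₀ ρ))
      ≤ eLpNorm (fun x => (P x - N x) - (P x₀ - N x₀)) p (volume.restrict (ball x₀ ρ)) +
          eLpNorm N p (volume.restrict (ball x₀ ρ)) := eLpNorm_add_le hmeas1 hmeas2 hp
    _ ≤ (volume (ball (0 : (EuclideanSpace ℝ (Fin 3))) ρ)) ^ p.toReal⁻¹ * ENNReal.ofReal (K₁ * (1 + ‖x₀‖) * ρ) +
          ENNReal.ofReal Bn := by
        gcongr
        · exact eLpNorm_restrict_ball_le_of_bound hmv p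
        · exact (eLpNorm_mono_measure N Measure.restrict_le_self).trans (hN x₀)
    _ = ENNReal.ofReal (V * (K₁ * (1 + ‖x₀‖) * ρ) + Bn) := by
        rw [ENNReal.ofReal_add (by positivity) hBn0, ENNReal.ofReal_mul hV0, hV,
          ENNReal.ofReal_toReal hVlt.ne]
    _ ≤ ENNReal.ofReal (K * (1 + ‖x₀‖)) := by
        refine ENNReal.ofReal_le_ofReal ?_
        rw [hK]
        nlinarith [norm_nonneg x₀, mul_nonneg hV0 hK₁0, mul_nonneg (mul_nonneg hV0 hK₁0) (norm_nonneg x₀)]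

/-- **Local pressure control for a rotated profile with `U ∈ L^q`, `4 ≤ q ≤ ∞`, in the `L²`
scale** (port of `IsLerayProfile.exists_local_pressure_bound_of_four_le`; the crux uses
`q = ∞`). -/
theorem exists_local_pressure_bound_of_four_le_of_rotated (hU : ContDiff ℝ ∞ U) (hP2 : ContDiff ℝ 2 P)
    (hB : ∀ x, ⟪B x, x⟫ = 0) (hdiv : VectorCalculus.IsDivFree U)
    (heq : ∀ y, -(ν • (Δ U) y) + a • U y + a • fderiv ℝ U y y + (B (U y) - fderiv ℝ U y (B y)) +
      convect U U y + gradient P y = 0)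
    (hν : 0 ≤ ν) (ha : 0 ≤ a) (hρ : 0 < ρ) {q : ℝ≥0∞} (hq : 4 ≤ q)
    (hUq : MemLp U q volume) :
    ∃ K : ℝ, 0 ≤ K ∧ ∀ x₀ : (EuclideanSpace ℝ (Fin 3)),
      (∀ y ∈ closedBall x₀ ρ, ‖fderiv ℝ (fun x => P x - normalisedPressure
        (fun w : EuclideanSpace ℝ (Fin 3) => cutoff (4 * ρ) (w - x₀) • U w) x) y‖ ≤ K * (1 + ‖x₀‖)) ∧
      eLpNorm (fun x => P x - (P x₀ - normalisedPressure
        (fun w : EuclideanSpace ℝ (Fin 3) => cutoff (4 * ρ) (w - x₀) • U w) x₀)) 2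
        (volume.restrict (ball x₀ ρ)) ≤ ENNReal.ofReal (K * (1 + ‖x₀‖)) := by
  obtain ⟨B', hB', hN⟩ := exists_eLpNorm_two_normalisedPressure_locF_le hU hρ hq hUq
  exact exists_local_pressure_bound_of_rotated hU hP2 hB hdiv heq hν ha hρ (le_trans (by norm_num) hq) hUq
    one_le_two hB' hN

end LocalPressure

end Summit.NavierStokesRegularity.NavierStokesRegularity.Theorems.CoriolisHead

end
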